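import Summits.RiemannHypothesis.RiemannHypothesis.Theses.SpectralTrace
import Summits.RiemannHypothesis.RiemannHypothesis.Theorems.SpectralTraceWindowCompactness
import Summits.RiemannHypothesis.RiemannHypothesis.Theorems.SpectralTraceWindowTraceToPositivity
import Literature.NumberTheory.LFunctions.WeilMarkovQuadratic
import Literature.NumberTheory.LFunctions.RiemannSiegel

/-!
# Line `Sketch` for the crux `WindowStep` (stmt-RiemannHypothesis-14659) — density-form positivity ladder

Skeleton (line lead, cycle 1), reshaped from ideator 1's `Sketch.lean` (cards
`Cruxes/WindowStep/Ideas/resonance-anatomy.md` + `phase-family-flow.md`).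

THE SITUATION. `WindowStep` (`∀ n ≥ 2, Trace(log n) → Trace(log (n+1))`) is kernel-checked to be
`WindowTraceArch → RH` (`Theorems/WindowStep/Negative/Collapse.lean`,
`windowStep_iff_windowTraceArch_imp_riemannHypothesis`): every line is an engine producing RH from the
seed, and the honest job of a skeleton is to say WHERE the RH-strength input sits and to make every
other step a theorem. The resonance-anatomy card locates it: the hypothesis `Trace(log n)` is used
only through Weil positivity on the half window (`windowTraceToPositivity_proof`, landed), and in
SPECTRAL DENSITY FORM positivity is an inequality for the truncated Weil density
`ρ_A(t) = θ'(t)/π − (1/π) Σ_{log m < A} Λ(m) m^{-1/2} cos(t log m)` integrated against `|ĝ(½+it)|²`;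
the density is negative only on a bounded "fold set" (`|t| ≤ T_det`, `stub_highZone`), the prime
power entering at the step is spectrally INVISIBLE (`stub_cutoffInvariance`: its cosine integrates to
`π(k(log n) + k(−log n)) = 0` against `|ĝ|²`), so the whole step is the growth of the TEST SPACE at a
fixed density (`stub_windowGrowth`, the RH-strength stub, held by the lead).

THE STUBS.
* `stub_densityForm` (M–L, provable now; the card's "First lemma" `DensityForm` at `T = 0`, which is
  no loss: modulation `g ↦ g·e^{iT·}` preserves the test class and the window): for a Weil test `g`
  supported in `[-a, a]`,
  `Re Q(g) = P(g) + (1/π)(∫ |ĝ(½+it)|² θ'(t) dt − Σ_{m ∈ weilPrimeIndex a} Λ(m) m^{-1/2} ∫ |ĝ(½+it)|² cos(t log m) dt)`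
  with `P = weilPoleForm` (tree), `θ' = riemannSiegelThetaDeriv = Re ψ(¼+it/2)/2 − (log π)/2` (tree).
  Ingredients, all in tree: `weilQuadratic_re_eq_weilPoleForm_add`, `weilMarkovQuadratic_eq_re`,
  `weilPrimeTerm_weilConv_weilReflect` / `weilConv_weilReflect_eq_zero_of_le_abs`,
  `weilArchIntegral_weilConv_weilReflect`, `weilConv_weilReflect_apply_zero`, Plancherel
  `integral_norm_sq_weilMellin_half_line`, Mellin inversion `weilMellin_inversion` applied to
  `k = g ⋆ g̃` with `k̂(½+it) = |ĝ(½+it)|²` (`weilMellin_weilConv_weilReflect_half`).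
* `stub_cutoffInvariance` (M, provable now): for `g` supported in `[-a, a]` and `2a ≤ |x|`,
  `∫ |ĝ(½+it)|² cos(t x) dt = 0` (`= π (k(x) + k(−x))`, and `k = g ⋆ g̃` vanishes off `(−2a, 2a)`).
* `stub_highZone` (S–M, provable now; the card's zone (iii) "above `T_det` nothing about zeros is
  needed"): for every finite set `S` of prime-power candidates and `|t| ≥ 2π·exp(2 Σ_{m∈S} Λ(m)/√m + 2)`,
  `Σ_{m∈S} Λ(m) m^{-1/2} cos(t log m) < θ'(t)` (from `abs_riemannSiegelThetaDeriv_sub_log_le`,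
  `riemannSiegelThetaDeriv_neg_holds`).
* `stub_windowGrowth` (RH-STRENGTH, held by the lead; fed the high-zone lemma): for every `n ≥ 2`,
  density positivity on the tests supported in `[-(log n)/2, (log n)/2]` with the prime cutoff
  `weilPrimeIndex ((log (n+1))/2) = {m : log m < log (n+1)}` implies the same on the tests supported
  in `[-(log (n+1))/2, (log (n+1))/2]`. Given the other three stubs it is EQUIVALENT to
  `∀ n ≥ 2, WeilPositivityOn ((log n)/2) → WeilPositivityOn ((log (n+1))/2)`, hence (with Yoshida's
  seed `weilPositivityOn_of_le_log_two_half`, landed) to RH — as Collapse says it must be.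

THE COMPOSITION `WindowStep_of` (kernel-checked below, sorries only in `stub_*`): from `Trace(log n)`,
positivity on `[-(log n)/2, (log n)/2]` (`windowTraceToPositivity_proof`); density form + cutoff
invariance turn it into density positivity at cutoff `{m ≤ n}`; `stub_windowGrowth` climbs the
rungs `m ≥ n` (cutoffs realigned by cutoff invariance at each rung); density form turns each rung
back into `WeilPositivityOn ((log m)/2)`; windows are monotone, so `WeilPositivityOn a` for every
`a > 0`; Yoshida/Weil criterion (`riemannHypothesis_iff_forall_weilPositivityOn`, unconditional in
the tree) gives RH; the explicit formula gives `Trace(log (n+1))`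
(`spectralThesis_of_riemannHypothesis`, every window at once).

TRUTH STATUS. `stub_densityForm`, `stub_cutoffInvariance`, `stub_highZone`: unconditional analysis,
provable now. `stub_windowGrowth`: RH-implied (RH ⇒ every `WeilPositivityOn`), irrefutable short of
`¬RH`, and RH-strength. No stub restates a refuted statement (`ledger negatives`: 0 for RH).

DISPROOF USED. `Cruxes/WindowStep/Disproof.lean` does not exist yet (no cdisprove seat has written
one; checked at session start 2026-08-16T06:5xZ). Honoured instead: Collapse (the composition goes
through RH openly); sibling `WindowTracePrime2/Disproof.lean` `…_false_without_IsWeilTest` (every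
stub quantifies over `IsWeilTest`; the density form needs smoothness for Plancherel/inversion).
-/

set_option linter.dupNamespace false

noncomputable section

open Complex Filter Set MeasureTheory
open scoped Real Topology BigOperators

namespace Summit.RiemannHypothesis.RiemannHypothesis.Cruxes.WindowStep.Sketch

open Literature.NumberTheory.LFunctions
open Summit.RiemannHypothesis.RiemannHypothesis.Theses.SpectralTrace

/-! ## The statements -/

/-- Density positivity on the window `[-a, a]` with prime cutoff `S`: for every Weil test `g`
supported in `[-a, a]`,
`0 ≤ P(g) + (1/π)(∫ |ĝ(½+it)|² θ'(t) dt − Σ_{m∈S} Λ(m) m^{-1/2} ∫ |ĝ(½+it)|² cos(t log m) dt)`.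
For `S ⊇ weilPrimeIndex a` this is `WeilPositivityOn a` (density form + cutoff invariance). -/
def DensityPos (a : ℝ) (S : Finset ℕ) : Prop :=
  ∀ g : ℝ → ℂ, IsWeilTest g → tsupport g ⊆ Icc (-a) a →
    0 ≤ weilPoleForm g + 1 / π *
      ((∫ t : ℝ, ‖weilMellin g (1 / 2 + t * I)‖ ^ 2 * riemannSiegelThetaDeriv t) -
        ∑ m ∈ S, (ArithmeticFunction.vonMangoldt m : ℝ) / Real.sqrt m *
          ∫ t : ℝ, ‖weilMellin g (1 / 2 + t * I)‖ ^ 2 * Real.cos (t * Real.log m))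

/-- Statement of `stub_densityForm`: Weil's quadratic functional in spectral density form. -/
def DensityFormStatement : Prop :=
  ∀ (g : ℝ → ℂ) (a : ℝ), IsWeilTest g → tsupport g ⊆ Icc (-a) a →
    (weilQuadratic g).re = weilPoleForm g + 1 / π *
      ((∫ t : ℝ, ‖weilMellin g (1 / 2 + t * I)‖ ^ 2 * riemannSiegelThetaDeriv t) -
        ∑ m ∈ weilPrimeIndex a, (ArithmeticFunction.vonMangoldt m : ℝ) / Real.sqrt m *
          ∫ t : ℝ, ‖weilMellin g (1 / 2 + t * I)‖ ^ 2 * Real.cos (t * Real.log m))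

/-- Statement of `stub_cutoffInvariance`: frequencies `|x| ≥ 2a` are invisible to `|ĝ|²`. -/
def CutoffInvarianceStatement : Prop :=
  ∀ (g : ℝ → ℂ) (a x : ℝ), IsWeilTest g → tsupport g ⊆ Icc (-a) a → 2 * a ≤ |x| →
    ∫ t : ℝ, ‖weilMellin g (1 / 2 + t * I)‖ ^ 2 * Real.cos (t * x) = 0

/-- Statement of `stub_highZone`: the truncated density is positive above the deterministic
height `T_det(S) = 2π·exp(2 Σ_{m∈S} Λ(m)/√m + 2)`. -/
def HighZoneStatement : Prop :=
  ∀ (S : Finset ℕ) (t : ℝ),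
    2 * π * Real.exp (2 * (∑ m ∈ S, (ArithmeticFunction.vonMangoldt m : ℝ) / Real.sqrt m) + 2) ≤ |t| →
      ∑ m ∈ S, (ArithmeticFunction.vonMangoldt m : ℝ) / Real.sqrt m * Real.cos (t * Real.log m) <
        riemannSiegelThetaDeriv t

/-- Statement of `stub_windowGrowth` (RH-strength): density positivity climbs one rung at fixed
prime cutoff, given the high-zone lemma. -/
def WindowGrowthStatement : Prop :=
  HighZoneStatement →
    ∀ n : ℕ, 2 ≤ n →
      DensityPos (Real.log n / 2) (weilPrimeIndex (Real.log ((n : ℝ) + 1) / 2)) →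
        DensityPos (Real.log ((n : ℝ) + 1) / 2) (weilPrimeIndex (Real.log ((n : ℝ) + 1) / 2))

/-! ## The registered stubs (signatures spelled out verbatim; `sorry` lives only here) -/

/-- **stub_densityForm — Weil's quadratic functional in spectral density form (M–L, provable
now).** For a Weil test `g` supported in `[-a, a]`,
`Re W(g ⋆ g̃) = P(g) + (1/π)(∫ |ĝ(½+it)|² θ'(t) dt − Σ_{log m < 2a} Λ(m) m^{-1/2} ∫ |ĝ(½+it)|² cos(t log m) dt)`,
`P = weilPoleForm`, `θ' = riemannSiegelThetaDeriv`. Proof: `Re Q = P + Q₀`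
(`weilQuadratic_re_eq_weilPoleForm_add`), `Q₀ = Re(−prime(k) + arch(k))`, `k = g ⋆ g̃`
(`weilMarkovQuadratic_eq_re`); `arch(k) = (1/2π)∫ |ĝ|² Re ψ(¼+it/2) − ‖g‖₂² log π`
(`weilArchIntegral_weilConv_weilReflect`, `weilConv_weilReflect_apply_zero`) and Plancherel
`∫|ĝ(½+it)|² = 2π‖g‖₂²` (`integral_norm_sq_weilMellin_half_line`) give `(1/π)∫|ĝ|²θ'`; the prime
term is the finite sum over `weilPrimeIndex a` (`weilPrimeTerm_weilConv_weilReflect` pattern) of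
`Λ(m)m^{-1/2}(k(log m) + k(−log m))` and `k(x) = (1/2π)∫ |ĝ(½+it)|² e^{−itx} dt`
(`weilMellin_inversion` for `k` at `c = 1/2`, `weilMellin_weilConv_weilReflect_half`). -/
theorem stub_densityForm :
    ∀ (g : ℝ → ℂ) (a : ℝ), Literature.NumberTheory.LFunctions.IsWeilTest g → tsupport g ⊆ Set.Icc (-a) a →
      (Literature.NumberTheory.LFunctions.weilQuadratic g).re =
        Literature.NumberTheory.LFunctions.weilPoleForm g + 1 / Real.pi *
          ((∫ t : ℝ, ‖Literature.NumberTheory.LFunctions.weilMellin g (1 / 2 + t * Complex.I)‖ ^ 2 *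
              Literature.NumberTheory.LFunctions.riemannSiegelThetaDeriv t) -
            ∑ m ∈ Literature.NumberTheory.LFunctions.weilPrimeIndex a,
              (ArithmeticFunction.vonMangoldt m : ℝ) / Real.sqrt m *
                ∫ t : ℝ, ‖Literature.NumberTheory.LFunctions.weilMellin g (1 / 2 + t * Complex.I)‖ ^ 2 *
                  Real.cos (t * Real.log m)) := by
  sorry

/-- **stub_cutoffInvariance — prime powers outside the window are spectrally invisible (M,
provable now).** For a Weil test `g` supported in `[-a, a]` and `2a ≤ |x|`,
`∫ |ĝ(½+it)|² cos(t x) dt = 0`: by Mellin/Fourier inversion for `k = g ⋆ g̃`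
(`k̂(½+it) = |ĝ(½+it)|²`), `∫ |ĝ(½+it)|² e^{−itx} dt = 2π k(x)`, and `k(±x) = 0` for `2a ≤ |x|`
(`weilConv_weilReflect_eq_zero_of_le_abs`). -/
theorem stub_cutoffInvariance :
    ∀ (g : ℝ → ℂ) (a x : ℝ), Literature.NumberTheory.LFunctions.IsWeilTest g → tsupport g ⊆ Set.Icc (-a) a →
      2 * a ≤ |x| →
        ∫ t : ℝ, ‖Literature.NumberTheory.LFunctions.weilMellin g (1 / 2 + t * Complex.I)‖ ^ 2 * Real.cos (t * x) = 0 := by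
  sorry

/-- **stub_highZone — the deterministic zone (S–M, provable now).** For a finite set `S ⊆ ℕ` put
`M = Σ_{m∈S} Λ(m)/√m`; if `|t| ≥ 2π e^{2M+2}` then `Σ_{m∈S} Λ(m) m^{-1/2} cos(t log m) < θ'(t)`:
indeed `θ'` is even (`riemannSiegelThetaDeriv_neg_holds`), `|θ'(u) − ½ log(u/2π)| ≤ 2/u` for `u ≥ 1`
(`abs_riemannSiegelThetaDeriv_sub_log_le`), `½ log(|t|/2π) ≥ M + 1`, `2/|t| < 1`, and the cosine
sum is at most `M` in absolute value (`Λ ≥ 0`). This is `T_det` of the resonance-anatomy card. -/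
theorem stub_highZone :
    ∀ (S : Finset ℕ) (t : ℝ),
      2 * Real.pi * Real.exp (2 * (∑ m ∈ S, (ArithmeticFunction.vonMangoldt m : ℝ) / Real.sqrt m) + 2) ≤ |t| →
        ∑ m ∈ S, (ArithmeticFunction.vonMangoldt m : ℝ) / Real.sqrt m * Real.cos (t * Real.log m) <
          Literature.NumberTheory.LFunctions.riemannSiegelThetaDeriv t := by
  sorry

/-- **stub_windowGrowth — the step in density form (RH-STRENGTH; held by the lead).** Given the
high-zone lemma: for every `n ≥ 2`, density positivity on the Weil tests supported in
`[-(log n)/2, (log n)/2]` at prime cutoff `{m : log m < log (n+1)}` implies density positivity on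
the tests supported in `[-(log (n+1))/2, (log (n+1))/2]` at the same cutoff. The prime power `n`
(the "spike" of the crux) is already in the cutoff on both sides and contributes nothing on the
smaller window (`stub_cutoffInvariance`): the content is the enlargement of the test space. With
the other stubs it is equivalent to `WeilPositivityOn ((log n)/2) → WeilPositivityOn ((log (n+1))/2)`
for all `n ≥ 2`, i.e. (Yoshida's seed being proved) to RH; it is RH-implied, so irrefutable short of
`¬RH`. Where it is decided (card `resonance-anatomy`): the integrand is `≥ 0` for
`|t| ≥ T_det` (`stub_highZone`), so failure needs spectral mass of `|ĝ|²` on the fold set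
`{|t| ≤ T_det, ρ < 0}` or a negative pole form; for `n ≤ 66` the fold set lies below `3·10¹²`
(Platt–Trudgian territory) but a CLUSTER-exclusion input above it is still required. -/
theorem stub_windowGrowth :
    (∀ (S : Finset ℕ) (t : ℝ),
      2 * Real.pi * Real.exp (2 * (∑ m ∈ S, (ArithmeticFunction.vonMangoldt m : ℝ) / Real.sqrt m) + 2) ≤ |t| →
        ∑ m ∈ S, (ArithmeticFunction.vonMangoldt m : ℝ) / Real.sqrt m * Real.cos (t * Real.log m) <
          Literature.NumberTheory.LFunctions.riemannSiegelThetaDeriv t) →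
    ∀ n : ℕ, 2 ≤ n →
      (∀ g : ℝ → ℂ, Literature.NumberTheory.LFunctions.IsWeilTest g →
        tsupport g ⊆ Set.Icc (-(Real.log n / 2)) (Real.log n / 2) →
          0 ≤ Literature.NumberTheory.LFunctions.weilPoleForm g + 1 / Real.pi *
            ((∫ t : ℝ, ‖Literature.NumberTheory.LFunctions.weilMellin g (1 / 2 + t * Complex.I)‖ ^ 2 *
                Literature.NumberTheory.LFunctions.riemannSiegelThetaDeriv t) -
              ∑ m ∈ Literature.NumberTheory.LFunctions.weilPrimeIndex (Real.log ((n : ℝ) + 1) / 2),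
                (ArithmeticFunction.vonMangoldt m : ℝ) / Real.sqrt m *
                  ∫ t : ℝ, ‖Literature.NumberTheory.LFunctions.weilMellin g (1 / 2 + t * Complex.I)‖ ^ 2 *
                    Real.cos (t * Real.log m))) →
      ∀ g : ℝ → ℂ, Literature.NumberTheory.LFunctions.IsWeilTest g →
        tsupport g ⊆ Set.Icc (-(Real.log ((n : ℝ) + 1) / 2)) (Real.log ((n : ℝ) + 1) / 2) →
          0 ≤ Literature.NumberTheory.LFunctions.weilPoleForm g + 1 / Real.pi *
            ((∫ t : ℝ, ‖Literature.NumberTheory.LFunctions.weilMellin g (1 / 2 + t * Complex.I)‖ ^ 2 *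
                Literature.NumberTheory.LFunctions.riemannSiegelThetaDeriv t) -
              ∑ m ∈ Literature.NumberTheory.LFunctions.weilPrimeIndex (Real.log ((n : ℝ) + 1) / 2),
                (ArithmeticFunction.vonMangoldt m : ℝ) / Real.sqrt m *
                  ∫ t : ℝ, ‖Literature.NumberTheory.LFunctions.weilMellin g (1 / 2 + t * Complex.I)‖ ^ 2 *
                    Real.cos (t * Real.log m)) := by
  sorry

/-! ## Consistency: each named statement IS its registered stub (definitionally) -/

theorem densityFormStatement_holds : DensityFormStatement := stub_densityForm
theorem cutoffInvarianceStatement_holds : CutoffInvarianceStatement := stub_cutoffInvariance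
theorem highZoneStatement_holds : HighZoneStatement := stub_highZone
theorem windowGrowthStatement_holds : WindowGrowthStatement := stub_windowGrowth

/-! ## Name-keyed aliases (the hypotheses of the composition) -/
namespace Registered

/-- Alias of `DensityFormStatement` keyed by the registered stub name. -/
abbrev stub_densityForm : Prop := DensityFormStatement
/-- Alias of `CutoffInvarianceStatement` keyed by the registered stub name. -/
abbrev stub_cutoffInvariance : Prop := CutoffInvarianceStatement
/-- Alias of `HighZoneStatement` keyed by the registered stub name. -/
abbrev stub_highZone : Prop := HighZoneStatement
/-- Alias of `WindowGrowthStatement` keyed by the registered stub name. -/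
abbrev stub_windowGrowth : Prop := WindowGrowthStatement

end Registered

/-! ## Lemmas of the composition (pure bookkeeping, no `sorry`) -/

/-- `weilPrimeIndex` is monotone in the window. -/
theorem weilPrimeIndex_mono {a b : ℝ} (hab : a ≤ b) : weilPrimeIndex a ⊆ weilPrimeIndex b := by
  intro m hm
  rw [mem_weilPrimeIndex] at hm ⊢
  linarith

/-- Cutoff invariance: enlarging the prime cutoff beyond the window does not change density
positivity. -/
theorem densityPos_iff_of_subset (hCI : CutoffInvarianceStatement) {a : ℝ} {S T : Finset ℕ}
    (hST : S ⊆ T) (hT : ∀ m ∈ T, m ∉ S → 2 * a ≤ Real.log m) :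
    DensityPos a S ↔ DensityPos a T := by
  have key : ∀ g : ℝ → ℂ, IsWeilTest g → tsupport g ⊆ Icc (-a) a →
      ∑ m ∈ T, (ArithmeticFunction.vonMangoldt m : ℝ) / Real.sqrt m *
          ∫ t : ℝ, ‖weilMellin g (1 / 2 + t * I)‖ ^ 2 * Real.cos (t * Real.log m) =
        ∑ m ∈ S, (ArithmeticFunction.vonMangoldt m : ℝ) / Real.sqrt m *
          ∫ t : ℝ, ‖weilMellin g (1 / 2 + t * I)‖ ^ 2 * Real.cos (t * Real.log m) := by
    intro g hg hgs
    rw [← Finset.sum_sdiff hST, add_eq_right]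
    refine Finset.sum_eq_zero fun m hm => ?_
    rw [Finset.mem_sdiff] at hm
    have h2a : 2 * a ≤ |Real.log m| := (hT m hm.1 hm.2).trans (le_abs_self _)
    rw [hCI g a (Real.log m) hg hgs h2a, mul_zero]
  constructor
  · intro h g hg hgs
    rw [key g hg hgs]
    exact h g hg hgs
  · intro h g hg hgs
    rw [← key g hg hgs]
    exact h g hg hgs

/-- Density form: `WeilPositivityOn a ↔ DensityPos a (weilPrimeIndex a)`. -/
theorem weilPositivityOn_iff_densityPos (hDF : DensityFormStatement) (a : ℝ) :
    WeilPositivityOn a ↔ DensityPos a (weilPrimeIndex a) := by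
  constructor
  · intro h g hg hgs
    rw [← hDF g a hg hgs]
    exact h g hg hgs
  · intro h g hg hgs
    rw [hDF g a hg hgs]
    exact h g hg hgs

/-- Realignment of the prime cutoff between consecutive half windows: on the tests supported in
`[-b, b]`, the cutoffs `weilPrimeIndex b` and `weilPrimeIndex c`, `b ≤ c`, give the same density
positivity (the extra candidates have `log m ≥ 2b`). -/
theorem densityPos_realign (hCI : CutoffInvarianceStatement) {b c : ℝ} (hbc : b ≤ c) :
    DensityPos b (weilPrimeIndex b) ↔ DensityPos b (weilPrimeIndex c) := by
  refine densityPos_iff_of_subset hCI (weilPrimeIndex_mono hbc) ?_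
  intro m _ hm
  rw [mem_weilPrimeIndex, not_lt] at hm
  exact hm

/-- `(log n)/2 ≤ (log (n+1))/2` for a natural number `n ≥ 1`. -/
theorem half_log_le_half_log_succ {n : ℕ} (hn : 1 ≤ n) :
    Real.log (n : ℝ) / 2 ≤ Real.log ((n : ℝ) + 1) / 2 := by
  have h0 : (0 : ℝ) < n := by exact_mod_cast hn
  have : Real.log (n : ℝ) ≤ Real.log ((n : ℝ) + 1) := Real.log_le_log h0 (by linarith)
  linarith

/-! ## The kernel-checked composition: the four stubs imply the crux, by name -/

/-- **The line concludes the crux BY NAME** (pure logic; no `sorry`). From `Trace(log n)`: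
Weil positivity on `[-(log n)/2, (log n)/2]` (`windowTraceToPositivity_proof`); in density form at
cutoff `weilPrimeIndex ((log n)/2)` (`stub_densityForm`), realigned to the cutoff of rung `n+1`
(`stub_cutoffInvariance`); `stub_windowGrowth` (fed `stub_highZone`) climbs every rung `m ≥ n`;
back through the density form, `WeilPositivityOn ((log m)/2)` for all `m ≥ n`, hence for every
window by monotonicity; RH by Yoshida/Weil (`riemannHypothesis_iff_forall_weilPositivityOn`); the
rung `log (n+1)` by the explicit formula (`spectralThesis_of_riemannHypothesis`). -/
theorem WindowStep_of (hDF : Registered.stub_densityForm) (hCI : Registered.stub_cutoffInvariance)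
    (hHZ : Registered.stub_highZone) (hWG : Registered.stub_windowGrowth) :
    Summit.RiemannHypothesis.RiemannHypothesis.Theses.SpectralTrace.WindowStep := by
  intro n hn hTr
  have hn1 : 1 ≤ n := le_trans (by norm_num) hn
  -- (1) positivity on the half window of rung `n`
  have hPos : WeilPositivityOn (Real.log n / 2) :=
    Summit.RiemannHypothesis.RiemannHypothesis.Theorems.windowTraceToPositivity_proof (Real.log n) hTr
  -- (2) density positivity at every rung `m ≥ n`, at the cutoff of rung `m + 1`
  have hDP : ∀ m : ℕ, n ≤ m →
      DensityPos (Real.log m / 2) (weilPrimeIndex (Real.log ((m : ℝ) + 1) / 2)) := by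
    intro m hm
    induction m, hm using Nat.le_induction with
    | base =>
      exact (densityPos_realign hCI (half_log_le_half_log_succ hn1)).1
        ((weilPositivityOn_iff_densityPos hDF _).1 hPos)
    | succ k hk ih =>
      have hk1 : 1 ≤ k + 1 := by omega
      have h : DensityPos (Real.log ((k : ℝ) + 1) / 2)
          (weilPrimeIndex (Real.log ((k : ℝ) + 1) / 2)) := hWG hHZ k (le_trans hn hk) ih
      have e : ((k + 1 : ℕ) : ℝ) = (k : ℝ) + 1 := by push_cast; ring
      have h' : DensityPos (Real.log ((k + 1 : ℕ) : ℝ) / 2)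
          (weilPrimeIndex (Real.log ((k + 1 : ℕ) : ℝ) / 2)) := by rw [e]; exact h
      exact (densityPos_realign hCI (half_log_le_half_log_succ hk1)).1 h'
  -- (3) back to Weil positivity on every half window of a rung `m ≥ n`
  have hPosAll : ∀ m : ℕ, n ≤ m → WeilPositivityOn (Real.log m / 2) := by
    intro m hm
    have hm1 : 1 ≤ m := le_trans hn1 hm
    exact (weilPositivityOn_iff_densityPos hDF _).2
      ((densityPos_realign hCI (half_log_le_half_log_succ hm1)).2 (hDP m hm))
  -- (4) every window: `a ≤ (log m)/2` for `m = max n ⌈e^{2a}⌉`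
  have hUniform : ∀ a : ℝ, 0 < a → WeilPositivityOn a := by
    intro a _
    obtain ⟨m, hm⟩ := exists_nat_ge (Real.exp (2 * a))
    have hm' : n ≤ max n m := le_max_left n m
    refine WeilPositivityOn.mono ?_ (hPosAll (max n m) hm')
    have hpos : (0 : ℝ) < ((max n m : ℕ) : ℝ) := by
      have : (1 : ℝ) ≤ ((max n m : ℕ) : ℝ) := by exact_mod_cast le_trans hn1 hm'
      linarith
    have hle : 2 * a ≤ Real.log ((max n m : ℕ) : ℝ) := by
      rw [Real.le_log_iff_exp_le hpos]
      exact hm.trans (by exact_mod_cast le_max_right n m)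
    linarith
  -- (5) RH (Yoshida/Weil criterion, unconditional in the tree), then every window at once by the
  --     explicit formula
  have hRH : _root_.RiemannHypothesis := riemannHypothesis_iff_forall_weilPositivityOn.2 hUniform
  obtain ⟨ι, γ, hγ⟩ :=
    Summit.RiemannHypothesis.RiemannHypothesis.Theorems.spectralThesis_of_riemannHypothesis hRH
  exact ⟨ι, γ, fun g hg _ => hγ g hg⟩

/-- Wiring check: the registered stubs feed `WindowStep_of` as stated (an `example`, so that no
sorry-tainted DECLARATION of this file has the crux as its type). -/
example : Summit.RiemannHypothesis.RiemannHypothesis.Theses.SpectralTrace.WindowStep :=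
  WindowStep_of stub_densityForm stub_cutoffInvariance stub_highZone stub_windowGrowth

end Summit.RiemannHypothesis.RiemannHypothesis.Cruxes.WindowStep.Sketch

end
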